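import Summits.Schanuel.Schanuel.Theorems.RootDecomp1KTorsionSubst

/-!
# RootDecomp1KTorsionHeights — §21 REV C «TORSION CELLS» port, part 2/5 (lens 6, gen 10 = ROUND 5 theorem round of route-Schanuel-RootDecomp1K on A₄ʰ stmt-Schanuel-33363)

Mechanical port (census-1 gen 8; tools tools/build_dark.py over census/tools/gen7/portkit2.py) of §21 of HOME/decomp-schanuel-lens-6/g10/addendum/TorsionCells.lean v2 (= scratch/Tor21.lean without its copied toolkit)
(sha256 b430567a…, 9025 l; critic VERDICT 2026-08-30T16:25:54Z ACCEPTED — amended F2⁗-1K (i) MET by the sub-class «torsion anchor»; census C-6) on top of the §17 wave Theorems/RootDecomp1KHyper01…19.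
This part: node lines 8190–8402 (20 declarations: torF, torF_eq_aeval, contDiff_torF, exists_lipschitz_torF, norm_mvaeval_le, len_le_two_pow_mul_mahlerMeasure …).
No named fact, no hypothesis (only tree-proved inputs);
statements and proofs
are otherwise the node's verbatim, in the wave namespace `Summit.Schanuel.Schanuel.Theorems.RootDecomp1KHyper` (sub-namespace `HyperCell`).
`--supports stmt-Schanuel-33363` (A₄ʰ HyperLiouvilleSchanuel: HYPOTHESIS-FREE decided n = 3 cells (2πi, ρ·2πi, w) and every torsion anchor s·πi (ρ hyper-Liouville), via algebraicIndependent_torsion — only input the tree-proved NW96 Thm 2(2) measure of π). Sorry-free; standard axioms. Nothing here proves Schanuel; rung 0.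
-/

set_option linter.dupNamespace false
set_option linter.unusedSectionVars false

noncomputable section

open Complex IntermediateField Filter Polynomial

namespace Summit.Schanuel.Schanuel.Theorems.RootDecomp1KHyper

variable {n K : ℕ}

namespace HyperCell

variable {n K : ℕ}

/-- `Φ_P(x) = Σ_s c_s x^{s₀} π^{s₁} e^{2πi s₂ x}… as `P(x, π, e^{2πix})`, a map `ℝ → ℂ`. -/
def torF (P : MvPolynomial (Fin 3) ℤ) (x : ℝ) : ℂ :=
  ∑ s ∈ P.support, ((P.coeff s : ℤ) : ℂ) *
    ((x : ℂ) ^ (s 0) * (Real.pi : ℂ) ^ (s 1) * cexp (2 * Real.pi * I * x) ^ (s 2))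

/-- §21g. The C¹ function x ↦ P(x, π, e^{2πix}): auxiliary statement `torF_eq_aeval` (lens 6 gen 10 node, ported verbatim). -/
theorem torF_eq_aeval (P : MvPolynomial (Fin 3) ℤ) (x : ℝ) :
    torF P x = MvPolynomial.aeval ![(x : ℂ), (Real.pi : ℂ), cexp (2 * Real.pi * I * x)] P := by
  unfold torF
  rw [MvPolynomial.aeval_def, MvPolynomial.eval₂_eq']
  refine Finset.sum_congr rfl fun s _ => ?_
  rw [Fin.prod_univ_three]
  simp only [algebraMap_int_eq, eq_intCast, Matrix.cons_val_zero, Matrix.cons_val_one,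
    Matrix.cons_val]

/-- §21g. The C¹ function x ↦ P(x, π, e^{2πix}): auxiliary statement `contDiff_torF` (lens 6 gen 10 node, ported verbatim). -/
theorem contDiff_torF (P : MvPolynomial (Fin 3) ℤ) : ContDiff ℝ 1 (torF P) := by
  have hx : ContDiff ℝ 1 (fun x : ℝ => (x : ℂ)) := Complex.ofRealCLM.contDiff
  unfold torF
  refine ContDiff.sum fun s _ => ?_
  refine contDiff_const.mul (((hx.pow _).mul contDiff_const).mul ?_)
  exact (Complex.contDiff_exp.comp (contDiff_const.mul hx)).pow _

/-- local Lipschitz bound of `torF P` at `ρ` -/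
theorem exists_lipschitz_torF (P : MvPolynomial (Fin 3) ℤ) (ρ : ℝ) :
    ∃ Kl δ₁ : ℝ, 0 ≤ Kl ∧ 0 < δ₁ ∧
      ∀ x : ℝ, |x - ρ| < δ₁ → ‖torF P x - torF P ρ‖ ≤ Kl * |x - ρ| := by
  obtain ⟨K, t, ht, hK⟩ := ((contDiff_torF P).contDiffAt (x := ρ)).exists_lipschitzOnWith
  obtain ⟨δ₁, hδ₁, hball⟩ := Metric.mem_nhds_iff.mp ht
  refine ⟨K, δ₁, K.2, hδ₁, fun x hx => ?_⟩
  have hxt : x ∈ t := hball (by rw [Metric.mem_ball, Real.dist_eq]; exact hx)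
  have hρt : ρ ∈ t := hball (Metric.mem_ball_self hδ₁)
  have := (lipschitzOnWith_iff_dist_le_mul.mp hK) x hxt ρ hρt
  rwa [dist_eq_norm, Real.dist_eq] at this

/-- a crude bound `‖P(v)‖ ≤ Σ_s |c_s| R₀^{s₀} R₁^{s₁} R₂^{s₂}` on a polydisc -/
theorem norm_mvaeval_le (P : MvPolynomial (Fin 3) ℤ) (v : Fin 3 → ℂ) {R₀ R₁ R₂ : ℝ}
    (h0 : ‖v 0‖ ≤ R₀) (h1 : ‖v 1‖ ≤ R₁) (h2 : ‖v 2‖ ≤ R₂) :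
    ‖MvPolynomial.aeval v P‖ ≤
      ∑ s ∈ P.support, ((|P.coeff s| : ℤ) : ℝ) * (R₀ ^ (s 0) * R₁ ^ (s 1) * R₂ ^ (s 2)) := by
  rw [MvPolynomial.aeval_def, MvPolynomial.eval₂_eq']
  refine (norm_sum_le _ _).trans (Finset.sum_le_sum fun s _ => ?_)
  rw [Fin.prod_univ_three, norm_mul, norm_mul, norm_mul, norm_pow, norm_pow, norm_pow,
    algebraMap_int_eq, eq_intCast, Complex.norm_intCast]
  have hR0 : 0 ≤ R₀ := (norm_nonneg _).trans h0
  have hR1 : 0 ≤ R₁ := (norm_nonneg _).trans h1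
  have hR2 : 0 ≤ R₂ := (norm_nonneg _).trans h2
  rw [Int.cast_abs]
  gcongr

/-- §21h. Length and height bookkeeping: auxiliary statement `len_le_two_pow_mul_mahlerMeasure` (lens 6 gen 10 node, ported verbatim). -/
private theorem len_le_two_pow_mul_mahlerMeasure (S : ℤ[X]) :
    (len S : ℝ) ≤ 2 ^ S.natDegree * (S.map (Int.castRingHom ℂ)).mahlerMeasure := by
  have hdeg : (S.map (Int.castRingHom ℂ)).natDegree = S.natDegree :=
    natDegree_map_eq_of_injective (RingHom.injective_int _) S
  unfold len
  push_cast
  calc ∑ k ∈ Finset.range (S.natDegree + 1), |((S.coeff k : ℤ) : ℝ)|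
      = ∑ k ∈ Finset.range (S.natDegree + 1), ‖(S.map (Int.castRingHom ℂ)).coeff k‖ := by
        refine Finset.sum_congr rfl fun k _ => ?_
        rw [Polynomial.coeff_map, eq_intCast, Complex.norm_intCast]
    _ ≤ ∑ k ∈ Finset.range (S.natDegree + 1),
          ((S.natDegree.choose k : ℕ) : ℝ) * (S.map (Int.castRingHom ℂ)).mahlerMeasure := by
        refine Finset.sum_le_sum fun k _ => ?_
        have := norm_coeff_le_choose_mul_mahlerMeasure k (S.map (Int.castRingHom ℂ))
        rwa [hdeg] at this
    _ = 2 ^ S.natDegree * (S.map (Int.castRingHom ℂ)).mahlerMeasure := by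
        rw [← Finset.sum_mul]
        congr 1
        exact_mod_cast Nat.sum_range_choose S.natDegree

/-- `Σ_s |c_s|` -/
def cP (P : MvPolynomial (Fin 3) ℤ) : ℤ := ∑ s ∈ P.support, |P.coeff s|

/-- §21h. Length and height bookkeeping: auxiliary statement `cP_nonneg` (lens 6 gen 10 node, ported verbatim). -/
theorem cP_nonneg (P : MvPolynomial (Fin 3) ℤ) : 0 ≤ cP P :=
  Finset.sum_nonneg fun _ _ => abs_nonneg _

/-- §21h. Length and height bookkeeping: auxiliary statement `one_le_cP` (lens 6 gen 10 node, ported verbatim). -/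
theorem one_le_cP {P : MvPolynomial (Fin 3) ℤ} {s₀ : Fin 3 →₀ ℕ} (hs₀ : s₀ ∈ P.support) :
    1 ≤ cP P := by
  unfold cP
  calc (1 : ℤ) ≤ |P.coeff s₀| := Int.one_le_abs (MvPolynomial.mem_support_iff.mp hs₀)
    _ ≤ ∑ s ∈ P.support, |P.coeff s| :=
        Finset.single_le_sum (f := fun s => |P.coeff s|) (fun _ _ => abs_nonneg _) hs₀

section SubstBounds

variable (P : MvPolynomial (Fin 3) ℤ) (D : ℕ) (p : ℤ) (q : ℕ)

/-- §21h. Length and height bookkeeping: auxiliary statement `abs_torCo_le` (lens 6 gen 10 node, ported verbatim). -/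
theorem abs_torCo_le {s : Fin 3 →₀ ℕ} (hs : s 0 ≤ D) :
    |torCo P D p q s| ≤ |P.coeff s| * (|p| + q) ^ D := by
  unfold torCo
  rw [abs_mul, abs_mul, abs_pow, abs_pow, Nat.abs_cast]
  have hq0 : (0 : ℤ) ≤ q := Int.natCast_nonneg q
  have hp0 : 0 ≤ |p| := abs_nonneg p
  have h1 : |p| ^ (s 0) ≤ (|p| + q) ^ (s 0) := pow_le_pow_left₀ hp0 (by linarith) _
  have h2 : (q : ℤ) ^ (D - s 0) ≤ (|p| + q) ^ (D - s 0) := pow_le_pow_left₀ hq0 (by linarith) _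
  calc |P.coeff s| * |p| ^ (s 0) * (q : ℤ) ^ (D - s 0)
      ≤ |P.coeff s| * (|p| + q) ^ (s 0) * (|p| + q) ^ (D - s 0) := by gcongr
    _ = |P.coeff s| * (|p| + q) ^ D := by
        rw [mul_assoc, ← pow_add, Nat.add_sub_cancel' hs]

/-- §21h. Length and height bookkeeping: auxiliary statement `abs_coeff_torG_le` (lens 6 gen 10 node, ported verbatim). -/
theorem abs_coeff_torG_le {K : ℕ} (hD : ∀ s ∈ P.support, s 0 ≤ D) (k : Fin (K + 1)) (j : ℕ) :
    |(torG P D p q K k).coeff j| ≤ cP P * (|p| + q) ^ D := by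
  rw [coeff_torG, cP, Finset.sum_mul]
  refine (Finset.abs_sum_le_sum_abs _ _).trans ?_
  have hpq : (0 : ℤ) ≤ (|p| + q) ^ D := by positivity
  calc ∑ s ∈ P.support with s 1 = (k : ℕ), |if s 2 = j then torCo P D p q s else 0|
      ≤ ∑ s ∈ P.support with s 1 = (k : ℕ), |P.coeff s| * (|p| + q) ^ D := by
        refine Finset.sum_le_sum fun s hs => ?_
        split_ifs
        · exact abs_torCo_le P D p q (hD s (Finset.mem_filter.mp hs).1)
        · rw [abs_zero]; positivity
    _ ≤ ∑ s ∈ P.support, |P.coeff s| * (|p| + q) ^ D :=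
        Finset.sum_le_sum_of_subset_of_nonneg (Finset.filter_subset _ _)
          fun _ _ _ => by positivity

/-- §21h. Length and height bookkeeping: auxiliary statement `len_torG_le` (lens 6 gen 10 node, ported verbatim). -/
theorem len_torG_le {K N : ℕ} (hD : ∀ s ∈ P.support, s 0 ≤ D) (hN : ∀ s ∈ P.support, s 2 ≤ N)
    (k : Fin (K + 1)) : len (torG P D p q K k) ≤ (N + 1) * (cP P * (|p| + q) ^ D) := by
  unfold len
  have hpos : (0 : ℤ) ≤ cP P * (|p| + q) ^ D := mul_nonneg (cP_nonneg P) (by positivity)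
  have hdeg := natDegree_torG_le P D p q K hN k
  calc ∑ j ∈ Finset.range ((torG P D p q K k).natDegree + 1), |(torG P D p q K k).coeff j|
      ≤ ∑ j ∈ Finset.range ((torG P D p q K k).natDegree + 1), cP P * (|p| + q) ^ D :=
        Finset.sum_le_sum fun j _ => abs_coeff_torG_le P D p q hD k j
    _ = (((torG P D p q K k).natDegree + 1 : ℕ) : ℤ) * (cP P * (|p| + q) ^ D) := by
        rw [Finset.sum_const, Finset.card_range, nsmul_eq_mul]
    _ ≤ (N + 1) * (cP P * (|p| + q) ^ D) := by
        refine mul_le_mul_of_nonneg_right ?_ hpos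
        exact_mod_cast Nat.succ_le_succ hdeg

/-- §21h. Length and height bookkeeping: auxiliary statement `relLen_torG_le` (lens 6 gen 10 node, ported verbatim). -/
theorem relLen_torG_le {K N : ℕ} (hD : ∀ s ∈ P.support, s 0 ≤ D) (hN : ∀ s ∈ P.support, s 2 ≤ N) :
    relLen (torG P D p q K) ≤ ((K : ℝ) + 1) * (((N : ℝ) + 1) * ((cP P : ℝ) * ((|p| : ℝ) + q) ^ D)) := by
  unfold relLen
  calc ∑ k : Fin (K + 1), (len (torG P D p q K k) : ℝ)
      ≤ ∑ _k : Fin (K + 1), (((N : ℝ) + 1) * ((cP P : ℝ) * ((|p| : ℝ) + q) ^ D)) := by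
        refine Finset.sum_le_sum fun k _ => ?_
        have := len_torG_le P D p q hD hN k
        have h' : ((len (torG P D p q K k) : ℤ) : ℝ) ≤ (((N + 1) * (cP P * (|p| + q) ^ D) : ℤ) : ℝ) := by
          exact_mod_cast this
        refine h'.trans (le_of_eq ?_)
        push_cast; ring
    _ = ((K : ℝ) + 1) * (((N : ℝ) + 1) * ((cP P : ℝ) * ((|p| : ℝ) + q) ^ D)) := by
        rw [Finset.sum_const, Finset.card_univ, Fintype.card_fin, nsmul_eq_mul]
        push_cast; ring

end SubstBounds

/-- §21i. The eliminant S = Res_X(Φ_q, Σ_k G_k(X) T^k) ∈ ℤ[T]: auxiliary statement `aeval_resPoly_cyclotomic` (lens 6 gen 10 node, ported verbatim). -/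
theorem aeval_resPoly_cyclotomic {K N : ℕ} (G : Fin (K + 1) → ℤ[X])
    (hN : ∀ k, (G k).natDegree ≤ N) {q : ℕ} (hq : 0 < q) (T₀ : ℂ) :
    aeval T₀ (resPoly (cyclotomic q ℤ) G N) =
      ∏ b ∈ primitiveRoots q ℂ, (conjFactor G b).eval T₀ := by
  rw [aeval_resPoly _ G hN, roots_cyclotomic_map hq]
  have hlc : ((cyclotomic q ℤ).map (Int.castRingHom ℂ)).leadingCoeff = 1 := by
    rw [map_cyclotomic_int]; exact (cyclotomic.monic q ℂ).leadingCoeff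
  rw [hlc, one_pow, one_mul, Finset.prod_eq_multiset_prod]

/-- §21i. The eliminant S = Res_X(Φ_q, Σ_k G_k(X) T^k) ∈ ℤ[T]: auxiliary statement `natDegree_resPoly_cyclotomic_le` (lens 6 gen 10 node, ported verbatim). -/
theorem natDegree_resPoly_cyclotomic_le {K N : ℕ} (G : Fin (K + 1) → ℤ[X])
    (hN : ∀ k, (G k).natDegree ≤ N) (q : ℕ) :
    (resPoly (cyclotomic q ℤ) G N).natDegree ≤ q * K := by
  refine (natDegree_resPoly_le _ G hN).trans ?_
  rw [natDegree_cyclotomic]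
  exact Nat.mul_le_mul_right K (Nat.totient_le q)

/-- §21i. The eliminant S = Res_X(Φ_q, Σ_k G_k(X) T^k) ∈ ℤ[T]: auxiliary statement `mahlerMeasure_resPoly_cyclotomic_le` (lens 6 gen 10 node, ported verbatim). -/
theorem mahlerMeasure_resPoly_cyclotomic_le {K N : ℕ} (G : Fin (K + 1) → ℤ[X])
    (hN : ∀ k, (G k).natDegree ≤ N) {q : ℕ} (hq : 0 < q) :
    ((resPoly (cyclotomic q ℤ) G N).map (Int.castRingHom ℂ)).mahlerMeasure ≤
      relLen G ^ q.totient := by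
  have h := mahlerMeasure_resPoly_le (cyclotomic q ℤ) (cyclotomic_ne_zero q ℤ) G hN
  rwa [mahlerMeasure_cyclotomic_map hq, one_pow, mul_one, natDegree_cyclotomic] at h

/-- **π's transcendence measure** (NW 1996 Thm 2 (2), PROVED in the tree), repackaged. -/
theorem pi_measure (S : ℤ[X]) (hS : S ≠ 0) {d : ℕ} (hd : 1 ≤ d) (hdeg : S.natDegree ≤ d)
    {Λ : ℝ} (hΛ : (len S : ℝ) + 3 ≤ Λ) :
    Real.exp (-(2 * 10 ^ 6 * (d : ℝ) * (Real.log Λ + d * Real.log d) * (1 + Real.log d))) ≤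
      ‖aeval (Real.pi : ℂ) S‖ := by
  set L : ℕ := (len S).toNat + 3 with hL
  have hlen0 : 0 ≤ len S := len_nonneg S
  have hLlen : len S ≤ (L : ℤ) := by
    rw [hL]; push_cast; rw [Int.toNat_of_nonneg hlen0]; linarith
  have hL3 : 3 ≤ L := by omega
  have h := Literature.NumberTheory.Transcendental.NesterenkoWaldschmidt1996_thm_2_2_holds
    S d L hS hd hdeg hLlen hL3
  refine le_trans (Real.exp_le_exp.mpr ?_) h
  have hLΛ : (L : ℝ) ≤ Λ := by
    have : (L : ℝ) = (len S : ℝ) + 3 := by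
      rw [hL]; push_cast; rw [show (((len S).toNat : ℕ) : ℝ) = ((len S : ℤ) : ℝ) from by
        exact_mod_cast Int.toNat_of_nonneg hlen0]
    linarith
  have hL0 : (0 : ℝ) < L := by exact_mod_cast (show 0 < L by omega)
  have hlog : Real.log L ≤ Real.log Λ := Real.log_le_log hL0 hLΛ
  have hd1 : (1 : ℝ) ≤ d := by exact_mod_cast hd
  have hlogd : 0 ≤ Real.log d := Real.log_nonneg hd1
  have h1 : 0 ≤ 1 + Real.log d := by linarith
  have h2 : 0 ≤ 2 * 10 ^ 6 * (d : ℝ) := by positivity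
  rw [neg_le_neg_iff]
  apply mul_le_mul_of_nonneg_right _ h1
  apply mul_le_mul_of_nonneg_left _ h2
  linarith

/-- §21j. Elementary exponential bounds: auxiliary statement `log_le_self_of_pos` (lens 6 gen 10 node, ported verbatim). -/
private theorem log_le_self_of_pos {x : ℝ} (hx : 0 < x) : Real.log x ≤ x := by
  linarith [Real.log_le_sub_one_of_pos hx]

/-- §21j. Elementary exponential bounds: auxiliary statement `pow_le_exp_mul` (lens 6 gen 10 node, ported verbatim). -/
theorem pow_le_exp_mul {Q : ℝ} (hQ : 1 ≤ Q) (D : ℕ) : Q ^ D ≤ Real.exp (D * Q) := by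
  have hQ0 : 0 < Q := by linarith
  calc Q ^ D = Real.exp (Real.log (Q ^ D)) := (Real.exp_log (pow_pos hQ0 D)).symm
    _ = Real.exp (D * Real.log Q) := by rw [Real.log_pow]
    _ ≤ Real.exp (D * Q) := Real.exp_le_exp.mpr (by
        exact mul_le_mul_of_nonneg_left (log_le_self_of_pos hQ0) (Nat.cast_nonneg D))

/-- §21j. Elementary exponential bounds: auxiliary statement `self_le_exp` (lens 6 gen 10 node, ported verbatim). -/
private theorem self_le_exp (x : ℝ) : x ≤ Real.exp x := by linarith [Real.add_one_le_exp x]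

end HyperCell

end Summit.Schanuel.Schanuel.Theorems.RootDecomp1KHyper
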